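import Literature.NumberTheory.GaloisRepresentations.HomPermutationResInjective
import Literature.NumberTheory.GaloisRepresentations.HomDualShaTwoExhaustion
import HarnessLib

/-!
# Input (A) of the `Ш²`-exhaustion — the local–global principle for `H²(K, Hom_ℤ(P, K̄ˣ))` on `Ш²`-classes — REDUCED to
# the vanishing of the classes `ev_m(res_{K(M)} c) ∈ H²(Γ_{K(M)}, K̄ˣ) = Br(K(M))`, `m ∈ M`

Topic `NumberTheory/GaloisRepresentations`; namespace `Literature.NumberTheory.GaloisRepresentations.HomDual`.
One definition with body (`evalFixedHom`: evaluation of `Hom_ℤ(X, A)` at a vector fixed by a subgroup) and theorems; no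
named fact, no instance, no `sorry`.  Sequel of `HomPermutationResInjective` (g7, step (A1): restriction to `Γ_{K(M)}` is
injective on `H²(K, Hom_ℤ(P, K̄ˣ))`) and `HomDualShaTwoExhaustion` (g7: (e) ⟸ (A) ∧ (B)).

THE MATHEMATICS.  `K` a number field, `ρ` finite `n`-torsion on `M`, `S : 0 → N₁ → P → M → 0` door-c4's presentation,
`U = Γ_{K(M)} = Gal(K̄/K(M))` (open normal; `K(M)` = `presentationLayer ρ`), `P = ℤ[Γ_K/U]^{|M|}` with its permuted basis
`(e_b)`.  Input (A) of `exists_shaTwoConnecting_eq_of_localGlobal` asks that `x := H²(p^*)(H²(e) c) ∈ H²(K, Hom_ℤ(P, K̄ˣ))`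
vanish for `c ∈ Ш²(K, M^D)`.
* (A1, `HomPermutationResInjective`) `res_U` is injective on `H²(K, Hom(P, K̄ˣ))`, so it suffices that `res_U x = 0`.
* (A2, §1 here) **`H²(U, Hom_ℤ(P, A)) ↪ ∏_b H²(U, A)`** by evaluation at the basis vectors, which `U` fixes
  (`eq_zero_of_forall_evalFixedHom_basis_eq_zero`: componentwise coboundaries `g_b` assemble to the coboundary
  `u ↦ (e_b ↦ g_b(u))`, the basis being finite).
* (§2) the `b`-component of `res_U x` is the single change-of-group map `H²(U ↪ Γ_K, ev_{m_b} : M^D → K̄ˣ)` applied to `c`,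
  where `m_b = p(e_b) ∈ M` and `ev_m(φ) = φ(m) ∈ μ_n ⊂ K̄ˣ` is `U`-equivariant because `U` fixes `M`
  (`evalPointHom`, `cohomologyMap_evalBasis_resH_eq`).
* **`localGlobal_of_forall_evalPoint`** — (A) ⟸ (A3): `∀ c ∈ Ш²(K, M^D), ∀ m : M, H²(U ↪ Γ_K, ev_m) c = 0` in
  `H²(U, K̄ˣ)` — the restriction of `c` to `Γ_{K(M)}`, read in `Br(K(M))` through any `m`, vanishes.  (A3) is
  Brauer–Hasse–Noether for `K(M)` (tree: `twoCocycle_cob_of_locallyTrivial`) once the local triviality of `c` at the places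
  of `K` is transported to the places of `K(M)` and `(U, K̄ˣ)` is identified with `(Γ_{K(M)}, \overline{K(M)}ˣ)`; NOT done here.
HONEST FRAMING: a reduction; no case of Poitou–Tate or BSD is proved here.

## References
* J. S. Milne, *Arithmetic Duality Theorems* (2nd ed. 2006), I Thm. 4.10 (a) (proof, p. 58), Lemma 4.13. [MilneADT2006]
* J.-P. Serre, *Galois Cohomology* (1997), I §2.5 Prop. 10, I §2.6 (b). [SerreGaloisCohomology1997]
* J. W. S. Cassels, A. Fröhlich (eds.), *Algebraic Number Theory* (1967), Ch. VII §9.6, §10 (Brauer–Hasse–Noether).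
  [CasselsFrohlichANT1967]
-/

noncomputable section

open CategoryTheory NumberField
open Field (absoluteGaloisGroup)
open scoped ContRepresentation

namespace Literature.NumberTheory.GaloisRepresentations

namespace HomDual

open Literature.Algebra.Homology Literature.Algebra.Homology.DiscreteRep DiscreteGaloisModule IdeleClassBar
  FreePresentation DGMBridge HomPermutation

/-! ## §1 Evaluation at a fixed vector; `H²(U, Hom(P, A)) ↪ ∏_b H²(U, A)` -/

section Eval

variable {K : Type} [Field K]
variable {X W : Type}
  [AddCommGroup X] [TopologicalSpace X] [DiscreteTopology X] [Module.Finite ℤ X]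
  [AddCommGroup W] [TopologicalSpace W] [DiscreteTopology W]
variable (ρX : DiscreteGaloisModule K X) (ρA : DiscreteGaloisModule K W) (U : Subgroup (absoluteGaloisGroup K))

/-- On `U` the action on `Hom(X, A)` evaluated at a `U`-fixed vector `x` is post-composition: `(u · F)(x) = u (F x)`.
[cite: MilneADT2006, I §0 (0.8)] -/
theorem restrict_hom_apply_fixed (x : X) (hx : ∀ u ∈ U, ρX u x = x) (u : U) (F : DiscreteRep.HomCarrier X W) :
    (show X →ₗ[ℤ] W from ((homGaloisModule ρX ρA).restrict (subgroupIncl U)) u F) x =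
      ρA (u : absoluteGaloisGroup K) ((show X →ₗ[ℤ] W from F) x) := by
  rw [ContinuousRep.restrict_apply]
  change (show X →ₗ[ℤ] W from homGaloisModule ρX ρA (u : absoluteGaloisGroup K) F) x = _
  rw [homGaloisModule_apply, LinearMap.comp_apply, LinearMap.comp_apply, ← Subgroup.coe_inv, hx _ (u⁻¹).2]

/-- **Evaluation `Hom_ℤ(X, A) → A`, `F ↦ F(x)`, at a vector `x` fixed by the subgroup `U`**: a `U`-equivariant continuous map
of the restricted modules (`(u · F)(x) = u (F (u⁻¹ x)) = u (F x)`). [cite: MilneADT2006, I §0 (0.8)] -/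
def evalFixedHom (x : X) (hx : ∀ u ∈ U, ρX u x = x) :
    ((homGaloisModule ρX ρA).restrict (subgroupIncl U)).toTopRep ⟶ (ρA.restrict (subgroupIncl U)).toTopRep :=
  TopRep.ofHom
    { toLinearMap := ({ toFun := fun F : DiscreteRep.HomCarrier X W => (show X →ₗ[ℤ] W from F) x
                        map_zero' := rfl
                        map_add' := fun _ _ => rfl } : DiscreteRep.HomCarrier X W →+ W).toIntLinearMap
      cont := continuous_of_discreteTopology
      isIntertwining' := fun u => by
        refine ContinuousLinearMap.ext fun F => ?_
        change (show X →ₗ[ℤ] W from ((homGaloisModule ρX ρA).restrict (subgroupIncl U)) u F) x =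
          (ρA.restrict (subgroupIncl U)) u ((show X →ₗ[ℤ] W from F) x)
        rw [restrict_hom_apply_fixed ρX ρA U x hx u F, ContinuousRep.restrict_apply]
        rfl }

omit [Module.Finite ℤ X] in
/-- Unfolding `evalFixedHom`. [cite: MilneADT2006, I §0 (0.8)] -/
@[simp] theorem evalFixedHom_hom_apply [Module.Finite ℤ X] (x : X) (hx : ∀ u ∈ U, ρX u x = x)
    (F : DiscreteRep.HomCarrier X W) :
    (evalFixedHom ρX ρA U x hx).hom F = (show X →ₗ[ℤ] W from F) x := rfl

variable {β : Type} (e : Module.Basis β ℤ X)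

/-- **`H²(U, Hom_ℤ(X, A)) ↪ ∏_b H²(U, A)`**: for `X` free on a basis `(e_b)` FIXED by the closed subgroup `U`, a class of
`H²(U, Hom_ℤ(X, A))` all of whose evaluations at the `e_b` vanish is zero (componentwise coboundaries `g_b` assemble to
the coboundary `u ↦ (e_b ↦ g_b u)`; the basis is finite, so this cochain is continuous).
[cite: SerreGaloisCohomology1997, I §2.2][cite: MilneADT2006, I §0 (0.8)] -/
theorem eq_zero_of_forall_evalFixedHom_basis_eq_zero [CompactSpace (absoluteGaloisGroup K)]
    (hU : IsClosed (U : Set (absoluteGaloisGroup K))) (he : ∀ u ∈ U, ∀ b : β, ρX u (e b) = e b)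
    (z : continuousCohomology 2 (((homGaloisModule ρX ρA).restrict (subgroupIncl U)).toTopRep))
    (hz : ∀ b : β, cohomologyMap (evalFixedHom ρX ρA U (e b) (fun u hu => he u hu b)) 2 z = 0) : z = 0 := by
  haveI : Finite β := Module.Finite.finite_basis e
  haveI : CompactSpace U := isCompact_iff_compactSpace.mp hU.isCompact
  obtain ⟨f, rfl⟩ := twoCocycleClass_surjective _ z
  -- componentwise coboundaries
  have hb : ∀ b : β, ∃ g : C(U, W), ∀ σ τ : U,
      (show X →ₗ[ℤ] W from (f.1 (σ, τ) : DiscreteRep.HomCarrier X W)) (e b) =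
        (ρA.restrict (subgroupIncl U)) σ (g τ) - g (σ * τ) + g σ := by
    intro b
    have h := hz b
    rw [cohomologyMap_twoCocycleClass, twoCocycleClass_eq_zero_iff] at h
    obtain ⟨g, hg⟩ := h
    exact ⟨g, fun σ τ => hg σ τ⟩
  choose g hg using hb
  -- the assembled cochain `u ↦ (e_b ↦ g_b u)`
  let G : C(U, DiscreteRep.HomCarrier X W) :=
    ⟨fun u => show DiscreteRep.HomCarrier X W from e.constr ℤ fun b => g b u,
      (continuous_of_discreteTopology (f := fun c : β → W => show DiscreteRep.HomCarrier X W from e.constr ℤ c)).comp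
        (continuous_pi fun b => (g b).continuous)⟩
  rw [twoCocycleClass_eq_zero_iff]
  refine ⟨G, fun σ τ => ?_⟩
  refine (e.ext fun b => ?_ : (show X →ₗ[ℤ] W from (f.1 (σ, τ) : DiscreteRep.HomCarrier X W)) =
    (show X →ₗ[ℤ] W from ((((homGaloisModule ρX ρA).restrict (subgroupIncl U)).toTopRep.ρ σ (G τ) - G (σ * τ) + G σ :
      DiscreteRep.HomCarrier X W))))
  rw [hg b σ τ]
  change _ = (show X →ₗ[ℤ] W from ((homGaloisModule ρX ρA).restrict (subgroupIncl U)) σ (G τ)) (e b) -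
    (e.constr ℤ fun b => g b (σ * τ)) (e b) + (e.constr ℤ fun b => g b σ) (e b)
  rw [e.constr_basis, e.constr_basis, ContinuousRep.restrict_apply,
    restrict_hom_apply_fixed ρX ρA U (e b) (fun u hu => he u hu b) σ (G τ)]
  change _ = ρA (σ : absoluteGaloisGroup K) ((e.constr ℤ fun b => g b τ) (e b)) - _ + _
  rw [e.constr_basis]
  rfl

end Eval

/-! ## §2 The presentation: input (A) from the vanishing of `ev_m(res_{K(M)} c)`, `m ∈ M` -/

section Presentation

variable {K : Type} [Field K] [NumberField K]
variable {M : Type} [AddCommGroup M] [TopologicalSpace M] [DiscreteTopology M] [Finite M]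
variable (ρ : DiscreteGaloisModule K M) (n : ℕ) (hM : ∀ m : M, n • m = 0)

/-- `U_{K(M)} = Γ_{K(M)}` (door-c4's `presentationLayer`, in the spelling `absGaloisFixingSubgroup`) fixes `M` pointwise.
[cite: MilneADT2006, I Lemma 1.9 (proof)] -/
theorem apply_eq_of_mem_absGaloisFixingSubgroup_presentationLayer {u : absoluteGaloisGroup K}
    (hu : haveI := (presentationLayer ρ).isGalois; u ∈ absGaloisFixingSubgroup (presentationLayer ρ).1) (m : M) :
    ρ u m = m :=
  haveI := (presentationLayer ρ).isGalois
  apply_eq_of_mem_presentationLayer ρ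
    ((IntermediateField.mem_fixingSubgroup_iff _ _).2 ((mem_absGaloisFixingSubgroup_iff _ _).1 hu)) m

/-- **`ev_m : M^D → K̄ˣ`, `φ ↦ φ(m) ∈ μ_n ⊂ K̄ˣ`, as a `U_{K(M)}`-equivariant map `M^D|_U → K̄ˣ|_U`** (the composite of
door-c6's `e = tateDualUnitsIso : M^D ≅ Hom_ℤ(M, K̄ˣ)` with evaluation at the `U`-fixed vector `m`).
[cite: MilneADT2006, I §0 (0.8), I §2] -/
def evalPointHom (m : M) :
    haveI := (presentationLayer ρ).isGalois
    TopRep.res (subgroupIncl (absGaloisFixingSubgroup (presentationLayer ρ).1) :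
        absGaloisFixingSubgroup (presentationLayer ρ).1 →* absoluteGaloisGroup K) (ρ.tateDual n).toTopRep ⟶
      ((units K).restrict (subgroupIncl (absGaloisFixingSubgroup (presentationLayer ρ).1))).toTopRep :=
  haveI := (presentationLayer ρ).isGalois
  haveI : Module.Finite ℤ M := Module.Finite.of_finite
  resAlongHom (subgroupIncl (absGaloisFixingSubgroup (presentationLayer ρ).1)) (tateDualUnitsIso K ρ n hM).hom ≫
    evalFixedHom ρ (units K) (absGaloisFixingSubgroup (presentationLayer ρ).1) m
      (fun _ hu => apply_eq_of_mem_absGaloisFixingSubgroup_presentationLayer ρ hu m)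

/-- Unfolding `evalPointHom`: `ev_m(φ) = ι(φ(m))`. [cite: MilneADT2006, I §0 (0.8), I §2] -/
theorem evalPointHom_hom_apply (m : M) (φ : TateDual K M n) :
    (evalPointHom ρ n hM m).hom φ = kummerInclAddHom K n (φ m) := rfl

/-- **The `b`-component of `res_U (H²(p^*)(H²(e) c))` is `H²(U ↪ Γ_K, ev_{m_b}) c`** with `m_b = p(e_b)`
(one change-of-group map: `ev_b ∘ p^* ∘ e = ev_{p(e_b)}` on `M^D`). [cite: MilneADT2006, I Thm. 4.10 (proof, p. 58)] -/
theorem cohomologyMap_evalBasis_resH_eq (c : galoisCohomology (ρ.tateDual n) 2) (b : PresIndex ρ) :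
    haveI := moduleFinite_presModule₂ ρ
    haveI := (presentationLayer ρ).isGalois
    cohomologyMap (evalFixedHom (presModule₂ ρ) (units K) (absGaloisFixingSubgroup (presentationLayer ρ).1)
        (presModuleBasis ρ b) (fun _ hu => apply_eq_self (uniformIsotropy_presIndex ρ) (permutedBasis_presModule₂ ρ) le_rfl hu _)) 2
      (resH (absGaloisFixingSubgroup (presentationLayer ρ).1) (homGaloisModule (presModule₂ ρ) (units K)) 2
        (cohomologyMap (dualF (presModule₂ ρ) ρ (units K) (presProj ρ)) 2
          (cohomologyMap (tateDualUnitsIso K ρ n hM).hom 2 c))) =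
      ContinuousCohomology.map (subgroupIncl (absGaloisFixingSubgroup (presentationLayer ρ).1))
        (evalPointHom ρ n hM (presProj ρ (presModuleBasis ρ b))) 2 c := by
  haveI := moduleFinite_presModule₂ ρ
  haveI := (presentationLayer ρ).isGalois
  set U := absGaloisFixingSubgroup (presentationLayer ρ).1
  -- `H²(p^*) ∘ H²(e) = H²(e ≫ p^*)`
  rw [← map_comp_apply_of (ContinuousMonoidHom.id _) (ContinuousMonoidHom.id _) (ContinuousMonoidHom.id _) (fun _ => rfl)
    (resIdHom (tateDualUnitsIso K ρ n hM).hom) (resIdHom (dualF (presModule₂ ρ) ρ (units K) (presProj ρ)))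
    (resIdHom ((tateDualUnitsIso K ρ n hM).hom ≫ dualF (presModule₂ ρ) ρ (units K) (presProj ρ))) (fun _ => rfl) 2 c]
  -- `res_U ∘ H²(e ≫ p^*) = H²(U ↪ Γ, (e ≫ p^*)|)`
  rw [← map_comp_apply_of (ContinuousMonoidHom.id _) (subgroupIncl U) (subgroupIncl U) (fun _ => rfl)
    (resIdHom ((tateDualUnitsIso K ρ n hM).hom ≫ dualF (presModule₂ ρ) ρ (units K) (presProj ρ)))
    (𝟙 (((homGaloisModule (presModule₂ ρ) (units K)).restrict (subgroupIncl U)).toTopRep))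
    (resAlongHom (subgroupIncl U) ((tateDualUnitsIso K ρ n hM).hom ≫ dualF (presModule₂ ρ) ρ (units K) (presProj ρ)))
    (fun _ => rfl) 2 c]
  -- `H²(ev_b) ∘ H²(U ↪ Γ, (e ≫ p^*)|) = H²(U ↪ Γ, ev_{p(e_b)})`
  exact (map_comp_apply_of (subgroupIncl U) (ContinuousMonoidHom.id _) (subgroupIncl U) (fun _ => rfl)
    (resAlongHom (subgroupIncl U) ((tateDualUnitsIso K ρ n hM).hom ≫ dualF (presModule₂ ρ) ρ (units K) (presProj ρ)))
    (resIdHom (evalFixedHom (presModule₂ ρ) (units K) U (presModuleBasis ρ b)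
      (fun _ hu => apply_eq_self (uniformIsotropy_presIndex ρ) (permutedBasis_presModule₂ ρ) le_rfl hu _)))
    (evalPointHom ρ n hM (presProj ρ (presModuleBasis ρ b))) (fun _ => rfl) 2 c).symm

/-- **Input (A) of `exists_shaTwoConnecting_eq_of_localGlobal` from (A3).**  IF for every `c ∈ Ш²(K, M^D)` and every
`m ∈ M` the class `H²(U ↪ Γ_K, ev_m) c ∈ H²(Γ_{K(M)}, K̄ˣ)` vanishes (the restriction of `c` to `Γ_{K(M)}`, where `M^D`
becomes `μ_n^{(M)}`, read in `Br(K(M))`; Brauer–Hasse–Noether for `K(M)` after transport of local triviality — NOT proved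
here), THEN `H²(p^*)(H²(e) c) = 0` in `H²(K, Hom_ℤ(P, K̄ˣ))`: by (A1) (`eq_zero_of_resH_two_presModule₂_eq_zero`) it suffices to
restrict to `U = Γ_{K(M)}`, by (A2) (`eq_zero_of_forall_evalFixedHom_basis_eq_zero`) to evaluate at the basis vectors, and the
components are these classes (`cohomologyMap_evalBasis_resH_eq`). HONEST FRAMING: a reduction.
[cite: MilneADT2006, I Thm. 4.10 (a) (proof, p. 58), Lemma 4.13][cite: CasselsFrohlichANT1967, Ch. VII §9.6, §10] -/
theorem localGlobal_of_forall_evalPoint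
    (hA3 : haveI := (presentationLayer ρ).isGalois
      ∀ c ∈ shaTwo (ρ.tateDual n), ∀ m : M,
        ContinuousCohomology.map (subgroupIncl (absGaloisFixingSubgroup (presentationLayer ρ).1))
          (evalPointHom ρ n hM m) 2 c = 0) :
    haveI := moduleFinite_presModule₂ ρ
    ∀ c ∈ shaTwo (ρ.tateDual n),
      cohomologyMap (dualF (presModule₂ ρ) ρ (units K) (presProj ρ)) 2 (cohomologyMap (tateDualUnitsIso K ρ n hM).hom 2 c) = 0 := by
  haveI := moduleFinite_presModule₂ ρ
  haveI := (presentationLayer ρ).isGalois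
  haveI := (presentationLayer ρ).finiteDimensional
  intro c hc
  refine eq_zero_of_resH_two_presModule₂_eq_zero ρ _ ?_
  refine eq_zero_of_forall_evalFixedHom_basis_eq_zero (presModule₂ ρ) (units K)
    (absGaloisFixingSubgroup (presentationLayer ρ).1) (presModuleBasis ρ)
    ((absGaloisFixingSubgroup (presentationLayer ρ).1).isClosed_of_isOpen
      (isOpen_absGaloisFixingSubgroup K (presentationLayer ρ).1))
    (fun u hu b => apply_eq_self (uniformIsotropy_presIndex ρ) (permutedBasis_presModule₂ ρ) le_rfl hu _) _ fun b => ?_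
  rw [cohomologyMap_evalBasis_resH_eq ρ n hM c b]
  exact hA3 c hc _

end Presentation

end HomDual

end Literature.NumberTheory.GaloisRepresentations

end
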